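import Summits.QuantumFields.YangMills.Theorems.WeakCouplingMasslessPhaseDeconfinedIsMasslessStrongExpDecayCentre
import Summits.QuantumFields.YangMills.Theorems.WeakCouplingMasslessPhaseDeconfinedIsMasslessNotPerimeterOfCentreUnbroken
import Summits.QuantumFields.YangMills.Theses.WeakCouplingMasslessPhase
import Literature.MathematicalPhysics.QuantumLattice.LatticeGaugeDLRLimitPointsProofs
import HarnessLib

/-!
# Crux `DeconfinedIsMassless` (stmt-QuantumFields-19521): Chatterjee's Definition 2.3 excludes the perimeter law;
# the crux reduces by name to the one-pair bridge A1 (route cone)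

Companion (`--supports stmt-QuantumFields-19521 --as helper`, closes nothing) of
`…DeconfinedIsMasslessStrongExpDecayCentre.lean` (this lane, g2: stub A's conclusion from Def. 2.3, route-independent) and of
the landed stub B `stub_not_perimeter_of_centreUnbroken` (p530803). Here the two are composed inside the route's cone:

* ★ `not_hasPerimeterLaw_of_hasStrongExpDecay` — **Definition 2.3 at `β > 0` excludes the fundamental perimeter law in EVERY
  torus limit state of `SU(N)₄`, `N ≥ 2`** (Chatterjee's Thm 2.4 ⇒ Thm 2.2 chain in the crux's torus-limit-state currency).
* ★ `deconfinedIsMassless_of_strongExpDecay_of_torusClustering` — **the crux reduces BY NAME to A1**: if for every `N ≥ 2`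
  and every lattice representation `r` some pair of species `A, B` has «volume-uniform torus clustering ⇒
  `HasStrongExpDecayZd 4 r.ρ β`» at every `β > 0`, then `DeconfinedIsMassless` holds (CONDITIONAL on A1, which is open and
  unregistered: this theorem credits nothing; it records what the remaining stub must deliver).

HONEST FRAMING. REFUTATION route; the crux is a confinement criterion used contrapositively; A1 is open.

Sources: S. Chatterjee, CMP 385 (2021), arXiv:2006.16229, Thm. 2.2, Thm. 2.4.
-/

set_option autoImplicit false

noncomputable section

namespace Summit.QuantumFields.YangMills.Theorems.DeconfinedIsMassless

open MeasureTheory Filter Topology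
open Literature.Probability.LatticeModels
open Literature.MathematicalPhysics
open Literature.MathematicalPhysics.QuantumLattice

variable {N : ℕ}

/-! ### With stub B: Definition 2.3 excludes the perimeter law in every torus limit state -/

/-- ★ **Chatterjee's Theorem 2.4 ⇒ Theorem 2.2 chain in the crux's currency**: for `N ≥ 2`, every lattice representation `r`
of `SU(N)` and every `β > 0` at which the `r`-Wilson theory satisfies Definition 2.3 (`HasStrongExpDecayZd 4 r.ρ β`), NO
infinite-volume torus limit state has the fundamental perimeter law (stub B, `stub_not_perimeter_of_centreUnbroken`, applied
to the inlined centre symmetry supplied by `slabCentre_inlined_of_hasStrongExpDecay`). [cite: Chatterjee2021, Thm. 2.4 and Thm. 2.2] -/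
theorem not_hasPerimeterLaw_of_hasStrongExpDecay :
    ∀ (N : ℕ), 2 ≤ N → ∀ r : QuantumFieldTheory.LatticeRep (Matrix.specialUnitaryGroup (Fin N) ℂ), ∀ β : ℝ, 0 < β →
      HasStrongExpDecayZd 4 r.ρ β →
      ∀ μ ∈ QuantumLattice.infiniteVolumeLimitPoints (d := 4) r.ρ β,
        ¬ QuantumLattice.HasPerimeterLaw μ (fun g => QuantumLattice.normalisedCharacter N (QuantumLattice.fundamentalRep (Fin N) g)) :=
  fun N hN r β hβ hdecay =>
    stub_not_perimeter_of_centreUnbroken N hN r β hβ (slabCentre_inlined_of_hasStrongExpDecay r β hdecay)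

/-! ### The crux reduces by name to the bridge A1 -/

/-- ★ **`DeconfinedIsMassless` from the one-pair bridge A1.** Suppose that for every `N ≥ 2` and every lattice representation
`r` of `SU(N)` there are species `A, B` such that, at every `β > 0`, volume-uniform exponential torus clustering of the
`(A,B)` connected correlator implies Chatterjee's Definition 2.3 for the `r`-Wilson theory (`HasStrongExpDecayZd 4 r.ρ β`).
Then the crux holds: a fundamental perimeter law in all torus limit states excludes such clustering — since clustering would
give Def. 2.3, hence (Thm. 2.4 + stub B) no perimeter law in any of the (non-empty set of) torus limit states.
[cite: Chatterjee2021, Thm. 2.4 and Thm. 2.2] -/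
theorem deconfinedIsMassless_of_strongExpDecay_of_torusClustering
    (hA1 : ∀ (N : ℕ), 2 ≤ N → ∀ r : QuantumFieldTheory.LatticeRep (Matrix.specialUnitaryGroup (Fin N) ℂ),
      ∃ A B : QuantumFieldTheory.YMSpecies (Matrix.specialUnitaryGroup (Fin N) ℂ), ∀ β : ℝ, 0 < β →
        (∃ (C m : ℝ) (S₀ : ℕ), 0 < m ∧ ∀ S : ℕ, S₀ ≤ S → ∀ n : ℕ, n ≤ S →
          |QuantumFieldTheory.latticeConnectedCorr r.ρ β (2 * S + 1) A.F B.F n| ≤ C * Real.exp (-(m * n))) →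
        HasStrongExpDecayZd 4 r.ρ β) :
    Summit.QuantumFields.YangMills.Theses.WeakCouplingMasslessPhase.DeconfinedIsMassless := by
  intro N hN r
  obtain ⟨A, B, hAB⟩ := hA1 N hN r
  refine ⟨A, B, fun β hβ hperim hclust => ?_⟩
  have hdecay := hAB β hβ hclust
  obtain ⟨μ, hμ⟩ := infiniteVolumeLimitPoints_nonempty_holds (d := 4) r.ρ r.continuous β
  exact not_hasPerimeterLaw_of_hasStrongExpDecay N hN r β hβ hdecay μ hμ (hperim μ hμ)

end Summit.QuantumFields.YangMills.Theorems.DeconfinedIsMassless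

end
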